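import Summits.HodgeConjecture.CorCM.MultiFieldWeilCrossDegreeMovers
import HarnessLib

/-!
# MULTI-FIELD WEIL ENGINE — QUARTIC SLOTS: stabiliser-transitivity INTO a slot of size `4` with `2`-TRANSITIVE image from a mover (primitivity), movers into
# such a slot from slots of sizes `3` and `5` for free, movers into a slot of size `5` from a slot of size `4` for free

Cell `pub-hodgecm2` (COR-CM), seat b30 gen 38 (2026-08-25); count-neutral own lane MULTI-FIELD WEIL ENGINE (stem `MultiFieldWeil*`), sequel of
`CorCM/MultiFieldWeilCrossDegreeMovers.lean` (Y2: sizes `5` and `3`; the kernel lemmas `card_dvd_index_ker_of_transitive`, `not_ker_le_ker_of_not_dvd_factorial`,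
`alternatingGroup_le_range_of_transitive_of_three_dvd` (Jordan), `index_ker_dvd_two_of_alternatingGroup_le_range` (simplicity of `𝔄₅`)) and of W1
`stabTransitive_of_mover_prime`.  Theorems only; no definition, no named fact, no `sorry`; group theory and its reading on the realised tuples — no geometry, no Markman
binder.  `HC_CM` is NOT touched.

THE POINT.  OCTIC CM fields through the imaginary quadratic `k` give slots of size `4` — not prime, so W1's block argument («one mover ⟹ transitive», blocks of prime
size) is unavailable, and genuinely fails: for `k·C` (`C` an `𝔖₃`-cubic) and the biquadratic `k·ℚ(√disc C, √b)` the tuples trivial at the cubic slot have orbits of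
size `2` on the quartic slot.  With a `2`-TRANSITIVE image on the quartic slot (quartic part `𝔄₄` or `𝔖₄`) everything is restored:
§1 (group theory) `descFactorial_two_dvd_index_ker_of_twoTransitive` (`|β|(|β|−1) ∣ [G : ker φ]` for a `2`-transitive image — Mathlib's `2`-pretransitivity on
`Fin 2 ↪ β`), `not_ker_le_ker_of_card_five_of_twelve_dvd` (`φ₀(G) ≤ Sym(5)` transitive, `12 ∣ [G : ker φ]`, `5 ∤ |β|!` ⟹ `ker φ₀ ≰ ker φ`: Jordan + `𝔄₅` simple, as in Y2).
§2 (model) **`stabTransitive_of_mover_twoTransitive`**: `R` `2`-transitive on the slot `m`, ONE mover trivial at `m₀` ⟹ the tuples trivial at `m₀` are TRANSITIVE on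
`m` (their orbits are blocks of a PRIMITIVE group — Mathlib `isPreprimitive_of_is_two_pretransitive` —, not singletons); movers into a `2`-transitive slot of size
`4` from a slot of size `3` (`4 ∤ 3!`) and from a slot of size `5` (`12 ∣ |G₅|` forces `G₅ ⊇ 𝔄₅`, which has no such quotient); movers into a slot of size `5` from a
slot of size `4` (`5 ∤ 4!`); packaged: `stabTransitive_into_four_of_three`, `stabTransitive_into_four_of_five`, `stabTransitive_into_five_of_four` — NO hypothesis
relating the two slots.  (INTO a slot of size `3` FROM a slot of size `4` a hypothesis IS needed: `𝔖₄ ↠ 𝔖₃`, the cubic resolvent; W1's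
`stabTransitive_realisedTuples_of_outside_prime` serves.  Between two slots of size `4`: a mover is needed — one value outside the closure, V2's
`exists_realisedTuple_trivial_apply_ne` — and then §2 applies.)
§3 (realised) the same for the realised tuples of CM fields through `k`, with the `2`-transitivity of `Aut(ℂ/τk)` on the `τ`-embeddings of an octic field read from
the automorphism form (`twoTransitive_realisedTuples_of_aut`).

[cite: DixonMortimer1996, §1.6, Thm. 1.6A; §3.3, Thm. 3.3A] [cite: Wielandt1964, §9–§10, §13 Thm. 13.3] [cite: Lang2002, I §5 Thm. 5.5] [cite: Shimura1998, §18.2 Lemma (i)]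

## References
* [DixonMortimer1996] J. D. Dixon, B. Mortimer, *Permutation Groups*, GTM 163, §1.6 Thm. 1.6A (blocks of a normal subgroup), §3.3 Thm. 3.3A (Jordan).
* [Wielandt1964] H. Wielandt, *Finite permutation groups*, §9–§10 (2-transitive ⟹ primitive), §13 Thm. 13.3.  [Lang2002] S. Lang, *Algebra*, GTM 211, I §5 Thm. 5.5.
  [Shimura1998] G. Shimura, *Abelian varieties with complex multiplication and modular functions*, §18.2 Lemma (i).
-/

noncomputable section

open CategoryTheory CategoryTheory.Limits NumberField IntermediateField

namespace Summit.HodgeConjecture.CorCM.MultiFieldWeil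

open Finset
open Literature.NumberTheory.ComplexMultiplication
open Summit.HodgeConjecture.CorCM.Census.MultiFieldWeil

open scoped Classical

/-! ## §1 Group theory: `2`-transitive images -/

section Group

variable {G : Type} [Group G]

/-- **A `2`-TRANSITIVE IMAGE HAS ORDER DIVISIBLE BY `|β|(|β|−1)`**: `φ : G → Sym(β)` moving every ordered pair of distinct points to every other ⟹
`|β|·(|β|−1) ∣ [G : ker φ]` (`G` is transitive on the `|β|(|β|−1)` embeddings `Fin 2 ↪ β`, and `ker φ` fixes them). [cite: Wielandt1964, §9] [cite: DixonMortimer1996, §1.6] -/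
theorem descFactorial_two_dvd_index_ker_of_twoTransitive {β : Type} [Fintype β] (hβ : 2 ≤ Fintype.card β) (φ : G →* Equiv.Perm β)
    (h2t : ∀ a b c d : β, a ≠ b → c ≠ d → ∃ g : G, φ g a = c ∧ φ g b = d) : (Fintype.card β).descFactorial 2 ∣ φ.ker.index := by
  letI : MulAction G β := MulAction.compHom β φ
  haveI : MulAction.IsMultiplyPretransitive G β 2 := MulAction.is_two_pretransitive_iff.2 fun {a b c d} hab hcd => h2t a b c d hab hcd
  obtain ⟨x⟩ : Nonempty (Fin 2 ↪ β) := Function.Embedding.nonempty_iff_card_le.2 (by rw [Fintype.card_fin]; exact hβ)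
  have hle : φ.ker ≤ MulAction.stabilizer G x := fun g hg => by
    rw [MonoidHom.mem_ker] at hg
    rw [MulAction.mem_stabilizer_iff]
    ext i
    rw [Function.Embedding.smul_apply]
    change φ g (x i) = x i
    rw [hg, Equiv.Perm.one_apply]
  have h := Subgroup.index_dvd_of_le hle
  rwa [MulAction.index_stabilizer_of_transitive G x, Nat.card_eq_fintype_card, Fintype.card_embedding_eq, Fintype.card_fin] at h

/-- **`5` LETTERS ONTO A `2`-TRANSITIVE QUARTIC IMAGE: NO FACTORING.**  `φ₀ : G → Sym(α)`, `|α| = 5`, transitive image; `φ : G → Sym(β)` with `12 ∣ [G : ker φ]` and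
`5 ∤ |β|!` (e.g. `|β| = 4`, `2`-transitive image).  Then `ker φ₀ ≰ ker φ`: otherwise `3 ∣ 12 ∣ [G : ker φ] ∣ |φ₀(G)|`, so `𝔄₅ ≤ φ₀(G)` (Jordan), so `[G : ker φ] ∣ 2` (Y2,
simplicity of `𝔄₅`), contradicting `12 ∣ [G : ker φ]`. [cite: DixonMortimer1996, §3.3, Thm. 3.3A] [cite: Lang2002, I §5 Thm. 5.5] -/
theorem not_ker_le_ker_of_card_five_of_twelve_dvd {α β : Type} [Fintype α] [Fintype β] (hα : Fintype.card α = 5) (h5 : ¬ 5 ∣ (Fintype.card β).factorial)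
    (φ₀ : G →* Equiv.Perm α) (φ : G →* Equiv.Perm β) (htr₀ : ∀ x y : α, ∃ g : G, φ₀ g x = y) (h12 : 12 ∣ φ.ker.index) :
    ¬ φ₀.ker ≤ φ.ker := fun hker => by
  let ε : α ≃ Fin 5 := Fintype.equivFinOfCardEq hα
  let φ₀' : G →* Equiv.Perm (Fin 5) := ε.permCongrHom.toMonoidHom.comp φ₀
  have happ : ∀ (g : G) (x : Fin 5), φ₀' g x = ε (φ₀ g (ε.symm x)) := fun g x => rfl
  have hker' : φ₀'.ker ≤ φ.ker := fun g hg => hker (by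
    rw [MonoidHom.mem_ker] at hg ⊢
    have h : ε.permCongrHom (φ₀ g) = 1 := hg
    exact (MulEquiv.map_eq_one_iff _).1 h)
  have htr₀' : ∀ x y : Fin 5, ∃ g : G, φ₀' g x = y := fun x y => by
    obtain ⟨g, hg⟩ := htr₀ (ε.symm x) (ε.symm y)
    exact ⟨g, by rw [happ, hg, Equiv.apply_symm_apply]⟩
  have h3 : 3 ∣ Nat.card φ₀'.range := by
    rw [← Subgroup.index_ker]
    exact ((show (3 : ℕ) ∣ 12 by norm_num).trans h12).trans (Subgroup.index_dvd_of_le hker')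
  have hA := alternatingGroup_le_range_of_transitive_of_three_dvd φ₀' htr₀' h3
  have h2 := index_ker_dvd_two_of_alternatingGroup_le_range φ₀' φ (by rwa [Nat.card_perm, Nat.card_eq_fintype_card]) hA hker'
  have h12' : 12 ∣ 2 := h12.trans h2
  omega

end Group

/-! ## §2 Model: `2`-transitive slots -/

section Model

variable {r : ℕ} {n : Fin r → ℕ} {R : Finset (PermsG n)}

/-- **INTO A `2`-TRANSITIVE SLOT, ONE MOVER GIVES STABILISER-TRANSITIVITY.**  `R ⊆ ∏_l Sym(n_l)` closed under products and inverses, non-empty, `2`-TRANSITIVE on the slot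
`m` (every ordered pair of distinct positions to every other); if ONE position of the slot `m` is moved by ONE tuple of `R` trivial at `m₀`, then the tuples of `R`
trivial at `m₀` are TRANSITIVE on the slot `m`: they form a normal subgroup, whose orbits are blocks of a PRIMITIVE group (`2`-transitive ⟹ primitive), hence
singletons or everything; a mover excludes singletons.  (W1 `stabTransitive_of_mover_prime` is the same with «prime size» for «`2`-transitive».)
[cite: DixonMortimer1996, §1.6, Thm. 1.6A] [cite: Wielandt1964, §9–§10] -/
theorem stabTransitive_of_mover_twoTransitive (hmul : ∀ π ∈ R, ∀ π' ∈ R, π * π' ∈ R) (hinv : ∀ π ∈ R, π⁻¹ ∈ R) (hne : R.Nonempty) {m₀ m : Fin r}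
    (h2t : ∀ a b a' b' : Fin (n m), a ≠ b → a' ≠ b' → ∃ π ∈ R, π m a = a' ∧ π m b = b')
    (hmov : ∃ a : Fin (n m), ∃ ν ∈ R, ν m₀ = 1 ∧ ν m a ≠ a) (a a' : Fin (n m)) : ∃ ν ∈ R, ν m₀ = 1 ∧ ν m a = a' := by
  classical
  let G : Subgroup (PermsG n) :=
    { carrier := ↑R
      mul_mem' := fun {π π'} hπ hπ' => hmul π hπ π' hπ'
      one_mem' := one_mem_of_closed hmul hinv hne
      inv_mem' := fun {π} hπ => hinv π hπ }
  let φ : ↥G →* Equiv.Perm (Fin (n m)) := (Pi.evalMonoidHom (fun l : Fin r => Equiv.Perm (Fin (n l))) m).comp G.subtype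
  let φ₀ : ↥G →* Equiv.Perm (Fin (n m₀)) := (Pi.evalMonoidHom (fun l : Fin r => Equiv.Perm (Fin (n l))) m₀).comp G.subtype
  let N : Subgroup ↥G := φ₀.ker
  letI : MulAction ↥G (Fin (n m)) := MulAction.compHom (Fin (n m)) φ
  have hsmulN : ∀ (g : ↥N) (x : Fin (n m)), g • x = ((g : ↥G) : PermsG n) m x := fun g x => rfl
  haveI : MulAction.IsMultiplyPretransitive ↥G (Fin (n m)) 2 := MulAction.is_two_pretransitive_iff.2 fun {x y x' y'} hxy hxy' => by
    obtain ⟨π, hπ, h, h'⟩ := h2t x y x' y' hxy hxy'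
    exact ⟨⟨π, hπ⟩, h, h'⟩
  haveI hprim : MulAction.IsPreprimitive ↥G (Fin (n m)) := MulAction.isPreprimitive_of_is_two_pretransitive inferInstance
  obtain ⟨a₀, ν₀, hν₀, hν₀1, hν₀a⟩ := hmov
  -- the orbit of `a₀` under `N` is a block of the primitive group `G`, with two points: it is everything
  have hB : MulAction.IsBlock ↥G (MulAction.orbit ↥N a₀) := MulAction.IsBlock.orbit_of_normal a₀
  let g₀ : ↥N := ⟨⟨ν₀, hν₀⟩, by rw [MonoidHom.mem_ker]; exact hν₀1⟩
  have huniv : MulAction.orbit ↥N a₀ = Set.univ := by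
    refine (hB.subsingleton_or_eq_univ).resolve_left fun hsub => hν₀a ?_
    have h := hsub (MulAction.mem_orbit a₀ g₀) (MulAction.mem_orbit_self a₀)
    rwa [hsmulN] at h
  have ha : a ∈ MulAction.orbit ↥N a₀ := by rw [huniv]; exact Set.mem_univ a
  have ha' : a' ∈ MulAction.orbit ↥N a₀ := by rw [huniv]; exact Set.mem_univ a'
  obtain ⟨g₁, hg₁⟩ := MulAction.mem_orbit_iff.1 ha
  obtain ⟨g₂, hg₂⟩ := MulAction.mem_orbit_iff.1 ha'
  refine ⟨(((g₂ * g₁⁻¹ : ↥N) : ↥G) : PermsG n), ((g₂ * g₁⁻¹ : ↥N) : ↥G).2, ?_, ?_⟩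
  · have h := (g₂ * g₁⁻¹).2
    rw [MonoidHom.mem_ker] at h
    exact h
  · have h : (g₂ * g₁⁻¹) • a = a' := by rw [mul_smul, ← hg₁, inv_smul_smul, hg₂]
    rw [hsmulN] at h
    exact h

/-- **MOVERS INTO A TRANSITIVE SLOT OF SIZE `4` FROM A SLOT OF SIZE `3`, AND INTO A TRANSITIVE SLOT OF SIZE `5` FROM A SLOT OF SIZE `4` — FREE** (`4 ∤ 3!`,
`5 ∤ 4!`): some tuple of `R` trivial at `m₀` moves a position of the slot `m`. [cite: DixonMortimer1996, §1.6] -/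
theorem exists_mover_of_sizes_three_four_or_four_five (hmul : ∀ π ∈ R, ∀ π' ∈ R, π * π' ∈ R) (hinv : ∀ π ∈ R, π⁻¹ ∈ R) (hne : R.Nonempty) {m₀ m : Fin r}
    (hsz : (n m₀ = 3 ∧ n m = 4) ∨ (n m₀ = 4 ∧ n m = 5)) (htr : ∀ a a' : Fin (n m), ∃ π ∈ R, π m a = a') :
    ∃ a : Fin (n m), ∃ ν ∈ R, ν m₀ = 1 ∧ ν m a ≠ a := by
  classical
  by_contra hno
  push Not at hno
  let Gs : Subgroup (PermsG n) :=
    { carrier := ↑R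
      mul_mem' := fun {π π'} hπ hπ' => hmul π hπ π' hπ'
      one_mem' := one_mem_of_closed hmul hinv hne
      inv_mem' := fun {π} hπ => hinv π hπ }
  let ev : ∀ l : Fin r, ↥Gs →* Equiv.Perm (Fin (n l)) := fun l => (Pi.evalMonoidHom (fun l : Fin r => Equiv.Perm (Fin (n l))) l).comp Gs.subtype
  have hev : ∀ (l : Fin r) (g : ↥Gs), ev l g = (g : PermsG n) l := fun l g => rfl
  have htr' : ∀ x y : Fin (n m), ∃ g : ↥Gs, ev m g x = y := fun x y => by
    obtain ⟨π, hπ, h⟩ := htr x y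
    exact ⟨⟨π, hπ⟩, h⟩
  have hker : (ev m₀).ker ≤ (ev m).ker := fun g hg => by
    rw [MonoidHom.mem_ker, hev] at hg ⊢
    ext a
    exact congrArg Fin.val (hno a (g : PermsG n) g.2 hg)
  haveI : Nonempty (Fin (n m)) := ⟨⟨0, by rcases hsz with ⟨-, h⟩ | ⟨-, h⟩ <;> omega⟩⟩
  have hdvd : n m ∣ (ev m).ker.index := by
    have h := card_dvd_index_ker_of_transitive (ev m) htr'
    rwa [Nat.card_eq_fintype_card, Fintype.card_fin] at h
  refine not_ker_le_ker_of_not_dvd_factorial (ev m₀) (ev m) hdvd ?_ hker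
  rw [Fintype.card_fin]
  rcases hsz with ⟨h₀, h⟩ | ⟨h₀, h⟩ <;> rw [h₀, h] <;> decide

/-- **MOVERS INTO A `2`-TRANSITIVE SLOT OF SIZE `4` FROM A TRANSITIVE SLOT OF SIZE `5` — FREE** (`12 ∣ |G₄|`, so no mover would make `G₄` a quotient of `G₅ ⊇ 𝔄₅`).
[cite: DixonMortimer1996, §3.3, Thm. 3.3A] [cite: Lang2002, I §5 Thm. 5.5] -/
theorem exists_mover_of_sizes_five_four (hmul : ∀ π ∈ R, ∀ π' ∈ R, π * π' ∈ R) (hinv : ∀ π ∈ R, π⁻¹ ∈ R) (hne : R.Nonempty) {m₀ m : Fin r}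
    (h5 : n m₀ = 5) (h4 : n m = 4) (htr₀ : ∀ a a' : Fin (n m₀), ∃ π ∈ R, π m₀ a = a')
    (h2t : ∀ a b a' b' : Fin (n m), a ≠ b → a' ≠ b' → ∃ π ∈ R, π m a = a' ∧ π m b = b') :
    ∃ a : Fin (n m), ∃ ν ∈ R, ν m₀ = 1 ∧ ν m a ≠ a := by
  classical
  by_contra hno
  push Not at hno
  let Gs : Subgroup (PermsG n) :=
    { carrier := ↑R
      mul_mem' := fun {π π'} hπ hπ' => hmul π hπ π' hπ'
      one_mem' := one_mem_of_closed hmul hinv hne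
      inv_mem' := fun {π} hπ => hinv π hπ }
  let ev : ∀ l : Fin r, ↥Gs →* Equiv.Perm (Fin (n l)) := fun l => (Pi.evalMonoidHom (fun l : Fin r => Equiv.Perm (Fin (n l))) l).comp Gs.subtype
  have hev : ∀ (l : Fin r) (g : ↥Gs), ev l g = (g : PermsG n) l := fun l g => rfl
  have htr₀' : ∀ x y : Fin (n m₀), ∃ g : ↥Gs, ev m₀ g x = y := fun x y => by
    obtain ⟨π, hπ, h⟩ := htr₀ x y
    exact ⟨⟨π, hπ⟩, h⟩
  have h2t' : ∀ a b a' b' : Fin (n m), a ≠ b → a' ≠ b' → ∃ g : ↥Gs, ev m g a = a' ∧ ev m g b = b' := fun a b a' b' hab hab' => by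
    obtain ⟨π, hπ, h, h'⟩ := h2t a b a' b' hab hab'
    exact ⟨⟨π, hπ⟩, h, h'⟩
  have hker : (ev m₀).ker ≤ (ev m).ker := fun g hg => by
    rw [MonoidHom.mem_ker, hev] at hg ⊢
    ext a
    exact congrArg Fin.val (hno a (g : PermsG n) g.2 hg)
  have h12 : 12 ∣ (ev m).ker.index := by
    have h := descFactorial_two_dvd_index_ker_of_twoTransitive (by rw [Fintype.card_fin, h4]; norm_num) (ev m) h2t'
    have h12' : (Fintype.card (Fin (n m))).descFactorial 2 = 12 := by rw [Fintype.card_fin, h4]; rfl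
    rwa [h12'] at h
  exact not_ker_le_ker_of_card_five_of_twelve_dvd (by rw [Fintype.card_fin, h5]) (by rw [Fintype.card_fin, h4]; decide) (ev m₀) (ev m) htr₀' h12 hker

/-- **INTO A `2`-TRANSITIVE SLOT OF SIZE `4` FROM A SLOT OF SIZE `3` OR `5`: STABILISER-TRANSITIVITY FOR FREE.**  `R` closed under products and inverses, non-empty,
transitive on `m₀` (size `3` or `5`) and `2`-transitive on `m` (size `4`): the tuples trivial at `m₀` are transitive on the slot `m`. [cite: DixonMortimer1996, §1.6, Thm. 1.6A; §3.3]
[cite: Wielandt1964, §9–§10] -/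
theorem stabTransitive_into_four (hmul : ∀ π ∈ R, ∀ π' ∈ R, π * π' ∈ R) (hinv : ∀ π ∈ R, π⁻¹ ∈ R) (hne : R.Nonempty) {m₀ m : Fin r}
    (hsz : n m₀ = 3 ∨ n m₀ = 5) (h4 : n m = 4) (htr₀ : ∀ a a' : Fin (n m₀), ∃ π ∈ R, π m₀ a = a')
    (h2t : ∀ a b a' b' : Fin (n m), a ≠ b → a' ≠ b' → ∃ π ∈ R, π m a = a' ∧ π m b = b') (a a' : Fin (n m)) :
    ∃ ν ∈ R, ν m₀ = 1 ∧ ν m a = a' := by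
  refine stabTransitive_of_mover_twoTransitive hmul hinv hne h2t ?_ a a'
  rcases hsz with h3 | h5
  · refine exists_mover_of_sizes_three_four_or_four_five hmul hinv hne (Or.inl ⟨h3, h4⟩) fun b b' => ?_
    by_cases hbb : b = b'
    · subst hbb
      exact ⟨1, one_mem_of_closed hmul hinv hne, rfl⟩
    · obtain ⟨π, hπ, h, -⟩ := h2t b b' b' b hbb (Ne.symm hbb)
      exact ⟨π, hπ, h⟩
  · exact exists_mover_of_sizes_five_four hmul hinv hne h5 h4 htr₀ h2t

/-- **INTO A SLOT OF SIZE `5` FROM A SLOT OF SIZE `4`: STABILISER-TRANSITIVITY FOR FREE** (a mover since `5 ∤ 4!`; blocks of prime size, W1).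
[cite: DixonMortimer1996, §1.6, Thm. 1.6A] -/
theorem stabTransitive_into_five_of_four (hmul : ∀ π ∈ R, ∀ π' ∈ R, π * π' ∈ R) (hinv : ∀ π ∈ R, π⁻¹ ∈ R) (hne : R.Nonempty) {m₀ m : Fin r}
    (h4 : n m₀ = 4) (h5 : n m = 5) (htr : ∀ a a' : Fin (n m), ∃ π ∈ R, π m a = a') (a a' : Fin (n m)) : ∃ ν ∈ R, ν m₀ = 1 ∧ ν m a = a' :=
  stabTransitive_of_mover_prime hmul hinv hne (by rw [h5]; exact Nat.prime_five) htr
    (exists_mover_of_sizes_three_four_or_four_five hmul hinv hne (Or.inr ⟨h4, h5⟩) htr) a a'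

end Model

/-! ## §3 Realised tuples -/

section Realised

variable {I : Type} {r : ℕ} {Kf : I → Type} [∀ i, Field (Kf i)] [∀ i, NumberField (Kf i)] {i₀ : I} {is : Fin r → I} {n : Fin r → ℕ}
  {e : ∀ m : Fin r, (Kf (is m) →+* ℂ) ≃ Fin (n m) × Bool} {τ : Kf i₀ →+* ℂ} {im : ∀ m : Fin r, Kf i₀ →+* Kf (is m)}
  (he_sign : ∀ (m : Fin r) (s : Kf (is m) →+* ℂ), (e m s).2 = true ↔ s.comp (im m) = τ)

omit [∀ i, NumberField (Kf i)] in
include he_sign in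
/-- **`2`-TRANSITIVITY OF THE REALISED TUPLES ON A SLOT FROM AUTOMORPHISMS**: if for all `τ`-embeddings `s₁ ≠ s₂`, `s₁' ≠ s₂'` of `K_m` some automorphism of `ℂ` over
`τ(k)` carries `s₁ ↦ s₁'` and `s₂ ↦ s₂'` (for an octic `K_m = k·F`: the quartic `F` has Galois group `𝔄₄` or `𝔖₄`), then the realised tuples are `2`-transitive on the slot
`m`. [cite: Shimura1998, §18.2 Lemma (i)] -/
theorem twoTransitive_realisedTuples_of_aut (m : Fin r)
    (h2T : ∀ s₁ s₂ s₁' s₂' : Kf (is m) →+* ℂ, s₁.comp (im m) = τ → s₂.comp (im m) = τ → s₁'.comp (im m) = τ → s₂'.comp (im m) = τ → s₁ ≠ s₂ → s₁' ≠ s₂' →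
      ∃ ρ : ℂ ≃+* ℂ, (ρ : ℂ →+* ℂ).comp τ = τ ∧ (ρ : ℂ →+* ℂ).comp s₁ = s₁' ∧ (ρ : ℂ →+* ℂ).comp s₂ = s₂')
    (a b a' b' : Fin (n m)) (hab : a ≠ b) (hab' : a' ≠ b') : ∃ π ∈ realisedTuples e τ, π m a = a' ∧ π m b = b' := by
  have hs : ∀ x : Fin (n m), ((e m).symm (x, true)).comp (im m) = τ := fun x => (he_sign m _).1 (by rw [Equiv.apply_symm_apply])
  have hne : ∀ x y : Fin (n m), x ≠ y → (e m).symm (x, true) ≠ (e m).symm (y, true) := fun x y hxy h =>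
    hxy (congrArg Prod.fst ((e m).symm.injective h))
  obtain ⟨ρ, hρ, h₁, h₂⟩ := h2T _ _ _ _ (hs a) (hs b) (hs a') (hs b') (hne a b hab) (hne a' b' hab')
  obtain ⟨π, hπ, hπρ⟩ := exists_mem_realisedTuples_of_comp_tau_eq (e := e) he_sign ρ hρ
  refine ⟨π, hπ, ?_, ?_⟩
  · have h := hπρ m a
    rw [h₁] at h
    exact ((Prod.mk.inj ((e m).symm.injective h)).1).symm
  · have h := hπρ m b
    rw [h₂] at h
    exact ((Prod.mk.inj ((e m).symm.injective h)).1).symm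

include he_sign in
/-- **REALISED: INTO A `2`-TRANSITIVE OCTIC SLOT FROM A SEXTIC OR DECIC SLOT, STABILISER-TRANSITIVITY FOR FREE** (`n_{m₀} ∈ {3, 5}`, `n_m = 4`, realised tuples
`2`-transitive on `m`). [cite: Shimura1998, §18.2 Lemma (i)] [cite: DixonMortimer1996, §1.6, Thm. 1.6A; §3.3] -/
theorem stabTransitive_realisedTuples_into_four (m₀ m : Fin r) (hsz : n m₀ = 3 ∨ n m₀ = 5) (h4 : n m = 4)
    (h2t : ∀ a b a' b' : Fin (n m), a ≠ b → a' ≠ b' → ∃ π ∈ realisedTuples e τ, π m a = a' ∧ π m b = b') (a a' : Fin (n m)) :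
    ∃ ν ∈ realisedTuples e τ, ν m₀ = 1 ∧ ν m a = a' :=
  stabTransitive_into_four (fun _ hπ _ hπ' => mul_mem_realisedTuples e τ hπ hπ') (fun _ hπ => inv_mem_realisedTuples hπ) (realisedTuples_nonempty (e := e) he_sign)
    hsz h4 (fun b b' => transitive_realisedTuples (e := e) he_sign m₀ b b') h2t a a'

include he_sign in
/-- **REALISED: INTO A DECIC SLOT FROM AN OCTIC SLOT, STABILISER-TRANSITIVITY FOR FREE** (`n_{m₀} = 4`, `n_m = 5`). [cite: Shimura1998, §18.2 Lemma (i)]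
[cite: DixonMortimer1996, §1.6, Thm. 1.6A] -/
theorem stabTransitive_realisedTuples_into_five_of_four (m₀ m : Fin r) (h4 : n m₀ = 4) (h5 : n m = 5) (a a' : Fin (n m)) :
    ∃ ν ∈ realisedTuples e τ, ν m₀ = 1 ∧ ν m a = a' :=
  stabTransitive_into_five_of_four (fun _ hπ _ hπ' => mul_mem_realisedTuples e τ hπ hπ') (fun _ hπ => inv_mem_realisedTuples hπ)
    (realisedTuples_nonempty (e := e) he_sign) h4 h5 (fun b b' => transitive_realisedTuples (e := e) he_sign m b b') a a'

include he_sign in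
/-- **REALISED: INTO A `2`-TRANSITIVE OCTIC SLOT FROM ANY SLOT, GIVEN ONE VALUE OUTSIDE THE GALOIS CLOSURE** (the mover of V2's `exists_realisedTuple_trivial_apply_ne`, then
§2): if some `τ`-embedding of `K_m` takes a value outside `L(K_{m₀})` and the realised tuples are `2`-transitive on the slot `m`, the realised tuples trivial at `m₀` are
transitive on the slot `m`. [cite: Lang2002, VI §1 Thm. 1.1 and Cor. 1.6] [cite: Shimura1998, §18.2 Lemma (i)] [cite: Wielandt1964, §9–§10] -/
theorem stabTransitive_realisedTuples_of_outside_twoTransitive (m₀ m : Fin r)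
    (h2t : ∀ a b a' b' : Fin (n m), a ≠ b → a' ≠ b' → ∃ π ∈ realisedTuples e τ, π m a = a' ∧ π m b = b')
    (hout : ∃ s : Kf (is m) →+* ℂ, s.comp (im m) = τ ∧ ∃ x, s x ∉ normalClosure ℚ (Kf (is m₀)) ℂ) (a a' : Fin (n m)) :
    ∃ ν ∈ realisedTuples e τ, ν m₀ = 1 ∧ ν m a = a' := by
  obtain ⟨s, hs, x, hx⟩ := hout
  have hs' : (e m).symm ((e m s).1, true) = s := by
    rw [show ((e m s).1, true) = e m s from Prod.ext rfl ((he_sign m s).2 hs).symm, Equiv.symm_apply_apply]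
  exact stabTransitive_of_mover_twoTransitive (fun _ hπ _ hπ' => mul_mem_realisedTuples e τ hπ hπ') (fun _ hπ => inv_mem_realisedTuples hπ)
    (realisedTuples_nonempty (e := e) he_sign) h2t
    ⟨(e m s).1, exists_realisedTuple_trivial_apply_ne he_sign (slot_pos_of_frame he_sign) m₀ m (e m s).1 ⟨x, by rw [hs']; exact hx⟩⟩ a a'

end Realised

end Summit.HodgeConjecture.CorCM.MultiFieldWeil

end
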